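import Literature.Computability.MetaComplexity.SmolenskyCorrelationRestrict
import Literature.Computability.MetaComplexity.RazborovSmolenskyApprox
import Literature.Computability.MetaComplexity.SmolenskyParity
import Summits.QuantumAdvantage.QuantumAdvantage.Theorems.MobiusLadderDigitPolyUniformityLARChooseMiddleLe
import HarnessLib

/-!
# Parity-product foreign rings, part 2/3: Walsh expansion of the all-odd event and the two-sided Smolensky bound
(support for item stmt-QuantumAdvantage-30910)

Cell decomp-qadv, seat lens-5, generation 8 — land port of §11 (lemmas) of the node «TameDial» (sha256 fd9002fb…).

Tools for `spreadDial_noAlgebraicShadow3` (part 3/3), tree/Literature only: `sgnOn A y = (-1)^{#ones of y on A}`,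
the Walsh expansion `walsh_allOdd` of the indicator of "every block has odd parity", the exact class count
`card_parity_classes`, the two-sided form `abs_sum_sgnOn_le` of `Smolensky.paritySubset_agreement_le` for
`{0,1}`-valued low-degree tests (`|∑_{ψ=1} (-1)^{⊕_A y}| ≤ 2·D·C(|A|,|A|/2)·2^{N-|A|}`… as typed below), the scale
choice `exists_scale` and the error budget `err_le`.
-/

set_option linter.style.longLine false
set_option linter.dupNamespace false

open Finset
open Literature.Computability.MetaComplexity

namespace Summit.QuantumAdvantage.QuantumAdvantage.Theorems.TameDial

variable {N : ℕ}

/-- number of ones of `y` on the coordinate set `A`. -/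
def pc (A : Finset (Fin N)) (y : Fin N → Bool) : ℕ := (A.filter fun a => y a = true).card

/-- the parity character `(-1)^{#ones on A}`. -/
def sgnOn (A : Finset (Fin N)) (y : Fin N → Bool) : ℤ := (-1) ^ pc A y

/-- SpreadDial helper `sgnOn_cases` (lens-5 g8 land package; see the module docstring). -/
theorem sgnOn_cases (A : Finset (Fin N)) (y : Fin N → Bool) : sgnOn A y = 1 ∨ sgnOn A y = -1 := by
  unfold sgnOn
  rcases Nat.even_or_odd (pc A y) with h | h
  · exact Or.inl h.neg_one_pow
  · exact Or.inr h.neg_one_pow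

/-- SpreadDial helper `sgnOn_eq_ite` (lens-5 g8 land package; see the module docstring). -/
theorem sgnOn_eq_ite (A : Finset (Fin N)) (y : Fin N → Bool) :
    sgnOn A y = if pc A y % 2 = 0 then 1 else -1 := by
  unfold sgnOn
  rcases Nat.even_or_odd (pc A y) with h | h
  · rw [h.neg_one_pow, if_pos (Nat.even_iff.mp h)]
  · rw [h.neg_one_pow, if_neg (by rw [Nat.odd_iff.mp h]; omega)]

/-- SpreadDial helper `sgnOn_eq_neg_one_iff` (lens-5 g8 land package; see the module docstring). -/
theorem sgnOn_eq_neg_one_iff (A : Finset (Fin N)) (y : Fin N → Bool) : sgnOn A y = -1 ↔ pc A y % 2 = 1 := by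
  rw [sgnOn_eq_ite]
  have := Nat.mod_two_eq_zero_or_one (pc A y)
  split_ifs with h
  · constructor
    · intro h1; norm_num at h1
    · intro h1; omega
  · constructor
    · intro _; omega
    · intro _; rfl

/-- SpreadDial helper `sgnOn_biUnion` (lens-5 g8 land package; see the module docstring). -/
theorem sgnOn_biUnion {ι : Type*} (J : Finset ι) (T : ι → Finset (Fin N))
    (hT : ∀ i ∈ J, ∀ j ∈ J, i ≠ j → Disjoint (T i) (T j)) (y : Fin N → Bool) :
    sgnOn (J.biUnion T) y = ∏ j ∈ J, sgnOn (T j) y := by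
  classical
  unfold sgnOn pc
  rw [Finset.filter_biUnion, Finset.card_biUnion, ← Finset.prod_pow_eq_pow_sum]
  intro i hi j hj hij
  exact disjoint_filter_filter (hT i hi j hj hij)

/-- **Walsh expansion of an AND of parities** (no disjointness needed): if every non-empty product character has
sum `≤ β` in absolute value over `S`, then `|2^r · #(S ∩ {all characters = -1}) - #S| ≤ (2^r - 1)·β`. -/
theorem walsh_allOdd {ι : Type*} [Fintype ι] [DecidableEq ι] (σ : ι → (Fin N → Bool) → ℤ)
    (hσ : ∀ j y, σ j y = 1 ∨ σ j y = -1) (S : Finset (Fin N → Bool)) (β : ℤ)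
    (hβ : ∀ J : Finset ι, J.Nonempty → |∑ y ∈ S, ∏ j ∈ J, σ j y| ≤ β)
    (A : Finset (Fin N → Bool)) (hAmem : ∀ y, y ∈ A ↔ y ∈ S ∧ ∀ j, σ j y = -1) :
    |2 ^ Fintype.card ι * (A.card : ℤ) - S.card| ≤ (2 ^ Fintype.card ι - 1) * β := by
  classical
  have hAeq : A = S.filter fun y => ∀ j, σ j y = -1 := by
    ext y; rw [hAmem, Finset.mem_filter]
  rw [hAeq]
  have hexp : ∀ y, ∏ j, (1 - σ j y) =
      ∑ J ∈ (univ : Finset ι).powerset, (-1) ^ J.card * ∏ j ∈ J, σ j y := by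
    intro y
    have h := Finset.prod_add (fun j => -σ j y) (fun _ => (1 : ℤ)) (univ : Finset ι)
    simp only [Finset.prod_const_one, mul_one] at h
    rw [show (∏ j, (1 - σ j y)) = ∏ j, (-σ j y + 1) from Finset.prod_congr rfl fun j _ => by ring, h]
    refine Finset.sum_congr rfl fun J _ => ?_
    rw [show (∏ j ∈ J, -σ j y) = ∏ j ∈ J, ((-1) * σ j y) from Finset.prod_congr rfl fun j _ => by ring,
      Finset.prod_mul_distrib, Finset.prod_const]
  have hval : ∀ y, ∏ j, (1 - σ j y) = if (∀ j, σ j y = -1) then (2 : ℤ) ^ Fintype.card ι else 0 := by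
    intro y
    split_ifs with h
    · rw [Finset.prod_congr rfl fun j _ => by rw [h j], Finset.prod_const, Finset.card_univ]; norm_num
    · push Not at h
      obtain ⟨j, hj⟩ := h
      have h1 : σ j y = 1 := (hσ j y).resolve_right hj
      exact Finset.prod_eq_zero (Finset.mem_univ j) (by rw [h1]; ring)
  have hlhs : (2 : ℤ) ^ Fintype.card ι * ((S.filter fun y => ∀ j, σ j y = -1).card : ℤ) =
      ∑ y ∈ S, ∏ j, (1 - σ j y) := by
    rw [Finset.sum_congr rfl fun y _ => hval y, Finset.sum_ite, Finset.sum_const_zero, add_zero, Finset.sum_const,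
      nsmul_eq_mul, mul_comm]
  rw [hlhs, Finset.sum_congr rfl fun y _ => hexp y, Finset.sum_comm,
    ← Finset.sum_erase_add _ _ (Finset.empty_mem_powerset (univ : Finset ι))]
  simp only [Finset.card_empty, pow_zero, Finset.prod_empty, mul_one, Finset.sum_const, nsmul_eq_mul,
    add_sub_cancel_right]
  calc |∑ J ∈ (univ : Finset ι).powerset.erase ∅, ∑ y ∈ S, (-1) ^ J.card * ∏ j ∈ J, σ j y|
      ≤ ∑ J ∈ (univ : Finset ι).powerset.erase ∅, |∑ y ∈ S, (-1) ^ J.card * ∏ j ∈ J, σ j y| :=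
        Finset.abs_sum_le_sum_abs _ _
    _ ≤ ∑ J ∈ (univ : Finset ι).powerset.erase ∅, β := Finset.sum_le_sum fun J hJ => by
        rw [← Finset.mul_sum, abs_mul, abs_pow, abs_neg, abs_one, one_pow, one_mul]
        exact hβ J (Finset.nonempty_iff_ne_empty.mpr (Finset.ne_of_mem_erase hJ))
    _ = (2 ^ Fintype.card ι - 1) * β := by
        rw [Finset.sum_const, nsmul_eq_mul, Finset.card_erase_of_mem (Finset.empty_mem_powerset _),
          Finset.card_powerset, Finset.card_univ]
        push_cast [Nat.one_le_two_pow]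
        ring

/-- both parity classes of a non-empty coordinate set have exactly `2^(N-1)` elements (read off the tree's Smolensky
bound at degree `0` for the constants `0` and `1`). -/
theorem card_parity_classes (A : Finset (Fin N)) (hA : A.Nonempty) :
    (univ.filter fun y : Fin N → Bool => pc A y % 2 = 0).card = 2 ^ (N - 1) ∧
    (univ.filter fun y : Fin N → Bool => pc A y % 2 = 1).card = 2 ^ (N - 1) := by
  classical
  have h2 : (2 : ZMod 3) ≠ 0 := by decide
  have hA1 : 1 ≤ A.card := Finset.card_pos.mpr hA
  have hAN : A.card ≤ N := by have := Finset.card_le_univ A; rwa [Fintype.card_fin] at this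
  have hAc : Aᶜ.card = N - A.card := by rw [Finset.card_compl, Fintype.card_fin]
  have hpow : 2 ^ Aᶜ.card * 2 ^ (A.card - 1) = 2 ^ (N - 1) := by
    rw [hAc, ← pow_add]; congr 1; omega
  have h0 := Smolensky.paritySubset_agreement_le (F := ZMod 3) A h2 (D := 0)
    (Q := (0 : Smolensky.CubeFn (ZMod 3) N)) (Submodule.zero_mem _)
  have h1 := Smolensky.paritySubset_agreement_le (F := ZMod 3) A h2 (D := 0)
    (Q := (1 : Smolensky.CubeFn (ZMod 3) N)) (Smolensky.one_mem_lowDeg 0)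
  rw [zero_mul, add_zero, hpow] at h0 h1
  have h0' : (univ.filter fun y : Fin N → Bool => pc A y % 2 = 0).card ≤ 2 ^ (N - 1) := by
    refine le_trans (Finset.card_le_card fun y hy => ?_) h0
    rw [Finset.mem_filter] at hy
    have hy2 : (A.filter fun i => y i = true).card % 2 = 0 := hy.2
    simp only [Finset.mem_filter, Finset.mem_univ, true_and]
    rw [Pi.zero_apply, if_neg (by omega)]
  have h1' : (univ.filter fun y : Fin N → Bool => pc A y % 2 = 1).card ≤ 2 ^ (N - 1) := by
    refine le_trans (Finset.card_le_card fun y hy => ?_) h1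
    rw [Finset.mem_filter] at hy
    have hy2 : (A.filter fun i => y i = true).card % 2 = 1 := hy.2
    simp only [Finset.mem_filter, Finset.mem_univ, true_and]
    rw [Pi.one_apply, if_pos hy2]
  have htot := Finset.card_filter_add_card_filter_not (s := (univ : Finset (Fin N → Bool)))
    (fun y : Fin N → Bool => pc A y % 2 = 0)
  have hneg : (univ.filter fun y : Fin N → Bool => ¬ pc A y % 2 = 0) =
      univ.filter fun y : Fin N → Bool => pc A y % 2 = 1 := filter_congr fun y _ => by omega
  rw [hneg, card_univ, Fintype.card_fun, Fintype.card_bool, Fintype.card_fin] at htot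
  have hN : 2 ^ N = 2 ^ (N - 1) + 2 ^ (N - 1) := by
    obtain ⟨M, rfl⟩ := Nat.exists_eq_add_of_le (le_trans hA1 hAN)
    rw [Nat.add_sub_cancel_left, pow_add, pow_one]; ring
  omega

/-- the support `{ψ = 1}` of a cube function. -/
def oneSet (ψ : Smolensky.CubeFn (ZMod 3) N) : Finset (Fin N → Bool) := univ.filter fun y => ψ y = 1

/-- SpreadDial helper `mem_oneSet` (lens-5 g8 land package; see the module docstring). -/
@[simp] theorem mem_oneSet (ψ : Smolensky.CubeFn (ZMod 3) N) (y : Fin N → Bool) : y ∈ oneSet ψ ↔ ψ y = 1 := by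
  simp [oneSet]

/-- **Smolensky's bias bound, two-sided, for a `{0,1}`-valued polynomial**: the parity character of a non-empty set
`A` has sum `≤ 2^(N-|A|)·D·C(|A|,|A|/2)` in absolute value over `{ψ = 1}` (apply the tree's one-sided bound to `ψ`
and to `1 - ψ`). -/
theorem abs_sum_sgnOn_le (A : Finset (Fin N)) (hA : A.Nonempty) {D : ℕ} {ψ : Smolensky.CubeFn (ZMod 3) N}
    (hψ : ψ ∈ Smolensky.lowDeg (ZMod 3) N D) (h01 : ∀ y, ψ y = 0 ∨ ψ y = 1) :
    |∑ y ∈ oneSet ψ, sgnOn A y| ≤ ((2 ^ (N - A.card) * (D * A.card.choose (A.card / 2)) : ℕ) : ℤ) := by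
  classical
  have h2 : (2 : ZMod 3) ≠ 0 := by decide
  obtain ⟨hev, hod⟩ := card_parity_classes A hA
  have hA1 : 1 ≤ A.card := Finset.card_pos.mpr hA
  have hAN : A.card ≤ N := by have := Finset.card_le_univ A; rwa [Fintype.card_fin] at this
  have hAc : Aᶜ.card = N - A.card := by rw [Finset.card_compl, Fintype.card_fin]
  have hpow : 2 ^ Aᶜ.card * 2 ^ (A.card - 1) = 2 ^ (N - 1) := by
    rw [hAc, ← pow_add]; congr 1; omega
  have hψ1 : ∀ y, ¬ ψ y = 1 ↔ ψ y = 0 := fun y => by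
    rcases h01 y with h | h
    · rw [h]; simp
    · rw [h]; simp
  -- the sum is #(oneSet ∩ even) - #(oneSet ∩ odd)
  have hsum : ∑ y ∈ oneSet ψ, sgnOn A y =
      (((oneSet ψ).filter fun y => pc A y % 2 = 0).card : ℤ) - ((oneSet ψ).filter fun y => pc A y % 2 = 1).card := by
    rw [Finset.sum_congr rfl fun y _ => sgnOn_eq_ite A y, Finset.sum_ite, Finset.sum_const, Finset.sum_const,
      nsmul_eq_mul, nsmul_eq_mul, mul_one, mul_neg, mul_one]
    have hneg : ((oneSet ψ).filter fun y => ¬ pc A y % 2 = 0) = (oneSet ψ).filter fun y => pc A y % 2 = 1 :=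
      filter_congr fun y _ => by omega
    rw [hneg]; ring
  -- the tree bound, for any `Q` of degree `≤ D`
  have key : ∀ (Q : Smolensky.CubeFn (ZMod 3) N), Q ∈ Smolensky.lowDeg (ZMod 3) N D →
      ∀ (G : Finset (Fin N → Bool)),
        (∀ y ∈ G, Q y = if (A.filter fun i => y i = true).card % 2 = 1 then 1 else 0) →
        (G.card : ℤ) ≤ 2 ^ (N - 1) + ((2 ^ (N - A.card) * (D * A.card.choose (A.card / 2)) : ℕ) : ℤ) := by
    intro Q hQ G hG
    have h := Smolensky.paritySubset_agreement_le (F := ZMod 3) A h2 hQ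
    rw [mul_add, hpow, hAc] at h
    have hG' : G.card ≤ 2 ^ (N - 1) + 2 ^ (N - A.card) * (D * A.card.choose (A.card / 2)) := by
      refine le_trans (Finset.card_le_card fun y hy => ?_) h
      simp only [Finset.mem_filter, Finset.mem_univ, true_and]
      exact hG y hy
    exact_mod_cast hG'
  -- agreement set of ψ :  (oneSet ∩ odd) ∪ (even \ oneSet)
  have hGψ := key ψ hψ
    (((oneSet ψ).filter fun y => pc A y % 2 = 1) ∪
      ((univ.filter fun y : Fin N → Bool => pc A y % 2 = 0).filter fun y => ¬ ψ y = 1)) (by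
      intro y hy
      rw [Finset.mem_union, Finset.mem_filter, Finset.mem_filter, Finset.mem_filter, mem_oneSet] at hy
      rcases hy with ⟨h1, hp⟩ | ⟨⟨_, hp⟩, h0⟩
      · rw [if_pos (by simpa [pc] using hp)]; exact h1
      · rw [if_neg (by simp only [pc] at hp; omega)]; exact (hψ1 y).mp h0)
  -- agreement set of 1 - ψ :  (odd \ oneSet) ∪ (oneSet ∩ even)
  have hG1ψ := key (1 - ψ) (Submodule.sub_mem _ (Smolensky.one_mem_lowDeg D) hψ)
    (((univ.filter fun y : Fin N → Bool => pc A y % 2 = 1).filter fun y => ¬ ψ y = 1) ∪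
      ((oneSet ψ).filter fun y => pc A y % 2 = 0)) (by
      intro y hy
      rw [Finset.mem_union, Finset.mem_filter, Finset.mem_filter, Finset.mem_filter, mem_oneSet] at hy
      simp only [Pi.sub_apply, Pi.one_apply]
      rcases hy with ⟨⟨_, hp⟩, h0⟩ | ⟨h1, hp⟩
      · rw [if_pos (by simpa [pc] using hp), (hψ1 y).mp h0, sub_zero]
      · rw [if_neg (by simp only [pc] at hp; omega), h1, sub_self])
  rw [Finset.card_union_of_disjoint (Finset.disjoint_left.mpr fun y ha hb => by
      rw [Finset.mem_filter] at ha hb; rw [Finset.mem_filter] at hb; have := hb.1.2; have := ha.2; omega)] at hGψ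
  rw [Finset.card_union_of_disjoint (Finset.disjoint_left.mpr fun y ha hb => by
      rw [Finset.mem_filter] at ha hb; rw [Finset.mem_filter] at ha; have := ha.1.2; have := hb.2; omega)] at hG1ψ
  -- complements inside a parity class
  have hce := Finset.card_filter_add_card_filter_not
    (s := univ.filter fun y : Fin N → Bool => pc A y % 2 = 0) (fun y => ψ y = 1)
  have hco := Finset.card_filter_add_card_filter_not
    (s := univ.filter fun y : Fin N → Bool => pc A y % 2 = 1) (fun y => ψ y = 1)
  have hce' : ((univ.filter fun y : Fin N → Bool => pc A y % 2 = 0).filter fun y => ψ y = 1).card =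
      ((oneSet ψ).filter fun y => pc A y % 2 = 0).card := by
    congr 1; ext y; simp only [Finset.mem_filter, mem_univ, true_and, mem_oneSet]; exact and_comm
  have hco' : ((univ.filter fun y : Fin N → Bool => pc A y % 2 = 1).filter fun y => ψ y = 1).card =
      ((oneSet ψ).filter fun y => pc A y % 2 = 1).card := by
    congr 1; ext y; simp only [Finset.mem_filter, mem_univ, true_and, mem_oneSet]; exact and_comm
  rw [hev, hce'] at hce
  rw [hod, hco'] at hco
  push_cast at hGψ hG1ψ
  have c1 : (((univ.filter fun y : Fin N → Bool => pc A y % 2 = 1).filter fun y => ¬ ψ y = 1).card : ℤ) =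
      2 ^ (N - 1) - ((oneSet ψ).filter fun y => pc A y % 2 = 1).card := by
    have h := congrArg (Nat.cast : ℕ → ℤ) hco; push_cast at h; linarith
  have c2 : (((univ.filter fun y : Fin N → Bool => pc A y % 2 = 0).filter fun y => ¬ ψ y = 1).card : ℤ) =
      2 ^ (N - 1) - ((oneSet ψ).filter fun y => pc A y % 2 = 0).card := by
    have h := congrArg (Nat.cast : ℕ → ℤ) hce; push_cast at h; linarith
  rw [hsum, abs_le]
  push_cast
  constructor <;> linarith

/-- growth bookkeeping: a polylogarithm is eventually below a root. -/
theorem exists_scale (r c' n₀ : ℕ) (hr : 1 ≤ r) :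
    ∃ s : ℕ, 1 ≤ s ∧ n₀ ≤ 8 * 2 ^ (r * s) ∧ ((r * s + 3) ^ c') ^ 2 * 4 ^ (r + 3) ≤ 2 ^ s := by
  have hK : (0 : ℝ) < ((4 * r : ℕ) : ℝ) ^ (2 * c') * 4 ^ (r + 3) := by positivity
  have hlim := tendsto_pow_const_div_const_pow_of_one_lt (2 * c') (by norm_num : (1 : ℝ) < 2)
  have hev := hlim.eventually (gt_mem_nhds (inv_pos.mpr hK))
  obtain ⟨S₀, hS₀⟩ := Filter.eventually_atTop.mp hev
  set s := max S₀ (max 1 n₀) with hs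
  have hs1 : 1 ≤ s := le_trans (le_max_left _ _) (le_max_right _ _)
  refine ⟨s, hs1, ?_, ?_⟩
  · calc n₀ ≤ s := le_trans (le_max_right _ _) (le_max_right _ _)
      _ ≤ 2 ^ s := Nat.lt_two_pow_self.le
      _ ≤ 2 ^ (r * s) := Nat.pow_le_pow_right (by norm_num) (Nat.le_mul_of_pos_left _ hr)
      _ ≤ 8 * 2 ^ (r * s) := Nat.le_mul_of_pos_left _ (by norm_num)
  · have hlt := hS₀ s (le_max_left _ _)
    have h2s : (0 : ℝ) < (2 : ℝ) ^ s := by positivity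
    rw [div_lt_iff₀ h2s] at hlt
    have hmain : ((((r * s + 3) ^ c') ^ 2 * 4 ^ (r + 3) : ℕ) : ℝ) < ((2 ^ s : ℕ) : ℝ) := by
      push_cast
      have e : (((r : ℝ) * s + 3) ^ c') ^ 2 = ((r : ℝ) * s + 3) ^ (2 * c') := by rw [← pow_mul]; ring
      rw [e]
      have hb' : ((r : ℝ) * s + 3) ^ (2 * c') ≤ (((4 * r : ℕ) : ℝ) * s) ^ (2 * c') := by
        apply pow_le_pow_left₀ (by positivity)
        have : r * s + 3 ≤ 4 * r * s := by nlinarith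
        exact_mod_cast this
      calc ((r : ℝ) * s + 3) ^ (2 * c') * 4 ^ (r + 3)
          ≤ (((4 * r : ℕ) : ℝ) * s) ^ (2 * c') * 4 ^ (r + 3) :=
            mul_le_mul_of_nonneg_right hb' (by positivity)
        _ = (((4 * r : ℕ) : ℝ) ^ (2 * c') * 4 ^ (r + 3)) * (s : ℝ) ^ (2 * c') := by rw [mul_pow]; ring
        _ < (((4 * r : ℕ) : ℝ) ^ (2 * c') * 4 ^ (r + 3)) *
              ((((4 * r : ℕ) : ℝ) ^ (2 * c') * 4 ^ (r + 3))⁻¹ * 2 ^ s) :=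
            mul_lt_mul_of_pos_left hlt hK
        _ = (2 : ℝ) ^ s := by field_simp
    exact_mod_cast hmain.le


/-- the error bookkeeping: `2^(n-m)·D·C(m,m/2) ≤ 2^(n-r-3)` as soon as `D²·4^(r+3) ≤ m ≤ n`
(from `C(m,m/2)²·m ≤ 4^m`). -/
theorem err_le {n m D r : ℕ} (hm : m ≤ n) (hD : D ^ 2 * 4 ^ (r + 3) ≤ m) :
    2 ^ (n - m) * (D * m.choose (m / 2)) ≤ 2 ^ (n - r - 3) := by
  have hc := Summit.QuantumAdvantage.DigitPolyUniformity.SketchLAR.ChooseMiddleLe.choose_half_sq_mul_le_all m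
  -- (D·C·2^(r+3))² ≤ 4^m
  have h1 : (D * m.choose (m / 2) * 2 ^ (r + 3)) ^ 2 ≤ (2 ^ m) ^ 2 := by
    have e4 : (4 : ℕ) ^ (r + 3) = (2 ^ (r + 3)) ^ 2 := by rw [← pow_mul, mul_comm, pow_mul]; norm_num
    have e4m : (4 : ℕ) ^ m = (2 ^ m) ^ 2 := by rw [← pow_mul, mul_comm, pow_mul]; norm_num
    calc (D * m.choose (m / 2) * 2 ^ (r + 3)) ^ 2
        = (D ^ 2 * 4 ^ (r + 3)) * m.choose (m / 2) ^ 2 := by rw [e4]; ring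
      _ ≤ m * m.choose (m / 2) ^ 2 := Nat.mul_le_mul_right _ hD
      _ = m.choose (m / 2) ^ 2 * m := by ring
      _ ≤ 4 ^ m := hc
      _ = (2 ^ m) ^ 2 := e4m
  have h2 : D * m.choose (m / 2) * 2 ^ (r + 3) ≤ 2 ^ m := (Nat.pow_le_pow_iff_left (by norm_num)).mp h1
  have h3 : 2 ^ (n - m) * (D * m.choose (m / 2)) * 2 ^ (r + 3) ≤ 2 ^ (n - r - 3) * 2 ^ (r + 3) := by
    calc 2 ^ (n - m) * (D * m.choose (m / 2)) * 2 ^ (r + 3)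
        = 2 ^ (n - m) * (D * m.choose (m / 2) * 2 ^ (r + 3)) := by ring
      _ ≤ 2 ^ (n - m) * 2 ^ m := Nat.mul_le_mul_left _ h2
      _ = 2 ^ n := by rw [← pow_add]; congr 1; omega
      _ ≤ 2 ^ (n - r - 3) * 2 ^ (r + 3) := by
          rw [← pow_add]; exact Nat.pow_le_pow_right (by norm_num) (by omega)
  exact Nat.le_of_mul_le_mul_right h3 (by positivity)


end Summit.QuantumAdvantage.QuantumAdvantage.Theorems.TameDial
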